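import Summits.BirchSwinnertonDyer.BirchSwinnertonDyer.Theorems.GenusKolyvaginAtTwoGenusPrimitiveSupplyAtTwoTwistingPrimeLevelFour
import HarnessLib

/-!
# Route `GenusKolyvaginAtTwo`, crux #2 `GenusPrimitiveSupplyAtTwo` (stmt-BirchSwinnertonDyer-22136):
# THE LEVEL-`4` CLASS EXISTS — `#Inf H¹(Gal(ℚ(E[2^M])/ℚ), E[2]) = 2` exactly (Lawson–Wuthrich's `H¹(GL₂(ℤ/4), 𝔽₂²) = 𝔽₂`)

Width seat `bsd-line-gk2-p4` g10, cell `bsd-f1-sign2`; helper (`--supports stmt-BirchSwinnertonDyer-22136`), §51 of the twisting-prime series.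
THEOREMS ONLY: no definition, no named fact, no `sorry`; no item is closed; BSD is not proved by this.

WHY. g8 (`eq_of_forall_torsionFixing_four_h1Eval_eq_zero`) and this seat's `…LevelFour` give AT MOST ONE non-zero class of `H¹(ℚ, E[2])`
dying on `Γ_{ℚ(E[2^M])}`; the entanglement criterion (`…EntangledCriterion`) is phrased in terms of that class. This file EXHIBITS it:
for `ρ_{E,4}` onto there IS a non-zero `ξ_E ∈ H¹(ℚ, E[2])` dying on `Γ_{ℚ(E[4])}`
(`exists_ne_zero_forall_torsionFixing_four_h1Eval_eq_zero`), hence on every `Γ_{ℚ(E[2^M])}`; so `#Inf = 2` EXACTLY at every level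
(`existsUnique_ne_zero_forall_torsionFixing_pow_h1Eval_eq_zero`).

THE COCYCLE (explicit, from halves of the `2`-torsion). Choose halves `P_T ∈ E[4]` of the points `T ∈ E[2]` (`2P_T = T`, `P_0 = 0`) and put
`D_T(σ) := σP_T − P_{σT} ∈ E[2]`. With the alternating form `w : E[2] × E[2] → 𝔽₂` (`w(x,y) = 1` iff `x, y` are distinct and non-zero —
the Weil pairing) let `β(x, y) := x + w(x,y)·y` (additive in `x`, `Aut E[2]`-equivariant). Then
  `ξ(σ) := Σ_{T ∈ E[2]} β(D_T(σ), σT)`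
is a continuous crossed homomorphism `Γ_ℚ → E[2]` (`D_T(στ) = σD_T(τ) + D_{τT}(σ)`, reindex the sum), vanishing on `Γ_{ℚ(E[4])}` (which
fixes every `P_T`), and NON-ZERO: on `t ∈ Γ_{ℚ(E[2])}` with level-`1` datum `A` (`tP = P + A(2P)` on `E[4]`), `ξ(t) = Σ_T β(A T, T)`, which
for `A = E₁₁` is `β(T₁,T₁) + β(T₁,T₁+T₂) = T₁ + T₂ ≠ 0`; a coboundary would vanish on `Γ_{ℚ(E[2])}`. (Without `β`'s twist the plain sum
`Σ_T D_T` is identically zero on `Γ_{ℚ(E[2])}` — the twist by the Weil form is what produces the Lawson–Wuthrich class.)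

References: [LawsonWuthrich2016] §3 (Lemma 6, Thm. 1: `H¹(GL₂(ℤ/4), 𝔽₂²) ≠ 0`); [Serre1972] §4; [GrossLMS1991] §9 Prop. 9.1.
-/

set_option linter.dupNamespace false -- tree convention: `Summit.BirchSwinnertonDyer.BirchSwinnertonDyer.Theorems` (summit = sub-problem)
set_option autoImplicit false

noncomputable section

open scoped Classical Pointwise

namespace Summit.BirchSwinnertonDyer.BirchSwinnertonDyer.Theorems.GenusKolyTwistingPrime

open WeierstrassCurve NumberField IsDedekindDomain Field
open Literature.NumberTheory.GaloisRepresentations Literature.NumberTheory.EllipticCurves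
open Literature.NumberTheory Matrix

/-! ## §51 The level-`4` class -/

section TwistForm

/-- **The twisted form `β(x,y) = x + w(x,y)·y` on `𝔽₂²` is additive in `x`** (`w(x,y) = x₀y₁ + x₁y₀`). [folklore] -/
theorem twistForm_add (x x' y : Fin 2 → ZMod 2) :
    (x + x') + ((x + x') 0 * y 1 + (x + x') 1 * y 0) • y =
      (x + (x 0 * y 1 + x 1 * y 0) • y) + (x' + (x' 0 * y 1 + x' 1 * y 0) • y) := by
  revert x x' y
  decide

/-- **… and `GL₂(𝔽₂)`-equivariant** (`w` is `SL₂ = GL₂`-invariant over `𝔽₂`). [folklore] -/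
theorem twistForm_mulVec (M M' : Matrix (Fin 2) (Fin 2) (ZMod 2)) (hMM' : M * M' = 1) (x y : Fin 2 → ZMod 2) :
    M *ᵥ x + ((M *ᵥ x) 0 * (M *ᵥ y) 1 + (M *ᵥ x) 1 * (M *ᵥ y) 0) • (M *ᵥ y) =
      M *ᵥ (x + (x 0 * y 1 + x 1 * y 0) • y) := by
  revert M M' x y
  decide

/-- **Non-vanishing instance**: `Σ_v β(E₁₁ v, v) = (1,1) ≠ 0`. [folklore] -/
theorem sum_twistForm_single_ne_zero :
    (∑ v : Fin 2 → ZMod 2, ((Matrix.single 0 0 (1 : ZMod 2)) *ᵥ v +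
      (((Matrix.single 0 0 (1 : ZMod 2)) *ᵥ v) 0 * v 1 + ((Matrix.single 0 0 (1 : ZMod 2)) *ᵥ v) 1 * v 0) • v)) ≠ 0 := by
  decide

end TwistForm

section LevelFourClass

variable (W : WeierstrassCurve ℚ) [W.IsElliptic]

/-- **THE LEVEL-`4` CLASS EXISTS.** For `W/ℚ` elliptic with `ρ_{W,4}` onto (nothing else) there is a NON-ZERO class `ξ ∈ H¹(ℚ, E[2])` with
`[ξ, h] = 0` for every `h ∈ Γ_{ℚ(E[4])}` — the inflation of the generator of `H¹(GL₂(ℤ/4), 𝔽₂²) = 𝔽₂` (Lawson–Wuthrich). Explicit cocycle: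
`ξ(σ) = Σ_{T ∈ E[2]} β(σP_T − P_{σT}, σT)` with `2P_T = T` and `β(x,y) = x + w(x,y)·y`, `w` the Weil form on `E[2]` (module docstring).
[cite: LawsonWuthrich2016, §3 (Lemma 6, Thm. 1)] [cite: GrossLMS1991, §9 Prop. 9.1] -/
theorem exists_ne_zero_forall_torsionFixing_four_h1Eval_eq_zero (hsurj4 : W.HasSurjectiveModNGaloisRep 4) :
    ∃ x : galH1Torsion W (2 : ℤ), x ≠ 0 ∧ ∀ h ∈ torsionFixing W (4 : ℤ), h1Eval W (2 : ℤ) x h = 0 := by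
  classical
  haveI : Fact (Nat.Prime 2) := ⟨Nat.prime_two⟩
  set Γ := absoluteGaloisGroup ℚ with hΓ
  have hT42 : torsionFixing W (4 : ℤ) ≤ torsionFixing W (2 : ℤ) :=
    KolyvaginLowerBoundAtTwo.torsionFixing_le_of_dvd W (by norm_num)
  -- ### a frame `e : E[2] ≃ 𝔽₂²` and the matrices of Galois elements
  have h2T : ∀ P : geomTorsion W (2 : ℤ), 2 • P = 0 := fun P ↦ AddSubgroup.torsionBy.nsmul P
  have hcard : Nat.card (geomTorsion W (2 : ℤ)) = 2 ^ 2 := natCard_geomTorsion_two_rat W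
  obtain ⟨e⟩ := KolyvaginImage.nonempty_addEquiv_of_card_eq_sq h2T hcard
  have hmat : ∀ σ : Γ, ∃ M : Matrix (Fin 2) (Fin 2) (ZMod 2), ∀ x : geomTorsion W (2 : ℤ), e (σ • x) = M *ᵥ e x := by
    intro σ
    refine ⟨LinearMap.toMatrix' ((e.toAddMonoidHom.comp
      ((DistribSMul.toAddMonoidHom (geomTorsion W (2 : ℤ)) σ).comp e.symm.toAddMonoidHom)).toZModLinearMap 2), fun x ↦ ?_⟩
    rw [← Matrix.toLin'_apply, Matrix.toLin'_toMatrix']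
    simp
  choose Mx hMx using hmat
  have hMinv : ∀ σ : Γ, Mx σ * Mx σ⁻¹ = 1 := by
    intro σ
    refine (Matrix.toLin'.injective ?_)
    apply LinearMap.ext
    intro v
    rw [Matrix.toLin'_mul, LinearMap.comp_apply, Matrix.toLin'_apply, Matrix.toLin'_apply, Matrix.toLin'_one,
      LinearMap.id_apply]
    have h := hMx σ (σ⁻¹ • e.symm v)
    rw [smul_inv_smul, e.apply_symm_apply, hMx σ⁻¹, e.apply_symm_apply] at h
    exact h.symm
  -- ### the twisted form `β` on `E[2]`
  let β : geomTorsion W (2 : ℤ) → geomTorsion W (2 : ℤ) → geomTorsion W (2 : ℤ) := fun x y ↦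
    e.symm (e x + ((e x) 0 * (e y) 1 + (e x) 1 * (e y) 0) • e y)
  have hβ : ∀ x y, β x y = e.symm (e x + ((e x) 0 * (e y) 1 + (e x) 1 * (e y) 0) • e y) := fun _ _ ↦ rfl
  have hβ_add : ∀ x x' y, β (x + x') y = β x y + β x' y := by
    intro x x' y
    rw [hβ, hβ, hβ, ← map_add e.symm, map_add e]
    exact congrArg e.symm (twistForm_add (e x) (e x') (e y))
  have hβ_zero : ∀ y, β 0 y = 0 := by
    intro y
    have h := hβ_add 0 0 y
    rw [add_zero] at h
    -- `β 0 y = β 0 y + β 0 y`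
    have : β 0 y + β 0 y - β 0 y = β 0 y - β 0 y := by rw [← h]
    rwa [add_sub_cancel_right, sub_self] at this
  have hβ_smul : ∀ (σ : Γ) x y, β (σ • x) (σ • y) = σ • β x y := by
    intro σ x y
    have hσ : ∀ z : geomTorsion W (2 : ℤ), σ • z = e.symm (Mx σ *ᵥ e z) := fun z ↦ by
      rw [← hMx σ z, e.symm_apply_apply]
    rw [hβ, hβ, hMx, hMx, hσ, twistForm_mulVec (Mx σ) (Mx σ⁻¹) (hMinv σ), e.apply_symm_apply]
  -- ### halves `P_T` of the `2`-torsion points (`P_0 = 0`)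
  have hdiv := W.zsmul_geomPoints_surjective_of_charZero (n := (2 : ℤ)) two_ne_zero
  choose half hhalf using fun T : geomTorsion W (2 : ℤ) ↦ hdiv (T : geomPoints W)
  let Ph : geomTorsion W (2 : ℤ) → geomPoints W := fun T ↦ if T = 0 then 0 else half T
  have hPh : ∀ T : geomTorsion W (2 : ℤ), (2 : ℤ) • Ph T = (T : geomPoints W) := by
    intro T
    by_cases hT : T = 0
    · simp only [Ph, hT, if_true, smul_zero]; rfl
    · simp only [Ph, hT, if_false]; exact hhalf T
  have hPh0 : Ph 0 = 0 := by simp [Ph]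
  have hPh4 : ∀ T, Ph T ∈ geomTorsion W (4 : ℤ) := by
    intro T
    rw [WeierstrassCurve.mem_geomTorsion_iff, show (4 : ℤ) = 2 * 2 by norm_num, mul_zsmul, hPh T]
    exact (WeierstrassCurve.mem_geomTorsion_iff W 2 _).mp T.2
  -- ### `D_T(σ) = σ P_T − P_{σT} ∈ E[2]`
  have hDmem : ∀ (σ : Γ) (T : geomTorsion W (2 : ℤ)), σ • Ph T - Ph (σ • T) ∈ geomTorsion W (2 : ℤ) := by
    intro σ T
    rw [WeierstrassCurve.mem_geomTorsion_iff, zsmul_sub, ← WeierstrassCurve.smul_zsmul_geomPoints, hPh, hPh, sub_eq_zero]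
    rfl
  let D : Γ → geomTorsion W (2 : ℤ) → geomTorsion W (2 : ℤ) := fun σ T ↦ ⟨σ • Ph T - Ph (σ • T), hDmem σ T⟩
  have hD : ∀ σ T, ((D σ T : geomTorsion W (2 : ℤ)) : geomPoints W) = σ • Ph T - Ph (σ • T) := fun _ _ ↦ rfl
  have hD_mul : ∀ (σ τ : Γ) T, D (σ * τ) T = σ • D τ T + D σ (τ • T) := by
    intro σ τ T
    apply Subtype.ext
    rw [AddSubgroup.coe_add, hD, hD, mul_smul, mul_smul]
    change _ = σ • (τ • Ph T - Ph (τ • T)) + _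
    rw [smul_sub]
    abel
  -- ### the cocycle `ξ(σ) = Σ_T β(D_T(σ), σT)` (sum over the frame)
  let ξ : Γ → geomTorsion W (2 : ℤ) := fun σ ↦ ∑ v : Fin 2 → ZMod 2, β (D σ (e.symm v)) (σ • e.symm v)
  have hξ : ∀ σ, ξ σ = ∑ v : Fin 2 → ZMod 2, β (D σ (e.symm v)) (σ • e.symm v) := fun _ ↦ rfl
  have hξ_mul : ∀ σ τ : Γ, ξ (σ * τ) = ξ σ + σ • ξ τ := by
    intro σ τ
    rw [hξ, hξ, hξ, Finset.smul_sum]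
    -- reindex the second sum along `v ↦ e (τ • e.symm v)`
    let π : (Fin 2 → ZMod 2) ≃ (Fin 2 → ZMod 2) :=
      { toFun := fun v ↦ e (τ • e.symm v)
        invFun := fun v ↦ e (τ⁻¹ • e.symm v)
        left_inv := fun v ↦ by simp
        right_inv := fun v ↦ by simp }
    have hπ : ∀ v, π v = e (τ • e.symm v) := fun _ ↦ rfl
    rw [← Equiv.sum_comp π (fun w ↦ β (D σ (e.symm w)) (σ • e.symm w)), ← Finset.sum_add_distrib]
    refine Finset.sum_congr rfl fun v _ ↦ ?_
    rw [hπ, e.symm_apply_apply, hD_mul, hβ_add, mul_smul, hβ_smul, add_comm]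
  -- ### `ξ` vanishes on `Γ_{ℚ(E[4])}`
  have hξ_zero : ∀ h ∈ torsionFixing W (4 : ℤ), ξ h = 0 := by
    intro h hh
    rw [hξ]
    refine Finset.sum_eq_zero fun v _ ↦ ?_
    have hfixT : h • e.symm v = e.symm v := smul_eq_of_mem_torsionFixing W (2 : ℤ) (hT42 hh) _
    have hD0 : D h (e.symm v) = 0 := by
      apply Subtype.ext
      rw [hD, hfixT, AddSubgroup.coe_zero, sub_eq_zero]
      have h4 := smul_eq_of_mem_torsionFixing W (4 : ℤ) hh ⟨Ph (e.symm v), hPh4 _⟩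
      exact congrArg (fun z : geomTorsion W (4 : ℤ) ↦ (z : geomPoints W)) h4
    rw [hD0, hβ_zero]
  -- ### continuity: `ξ` is constant on the cosets of the open subgroup `Γ_{ℚ(E[4])}`
  have hξ_cont : Continuous ξ := by
    refine continuous_def.mpr fun S _ ↦ ?_
    refine isOpen_iff_mem_nhds.mpr fun σ hσ ↦ ?_
    have hopen : IsOpen ((fun h : Γ ↦ σ * h) '' (torsionFixing W (4 : ℤ) : Set Γ)) :=
      (Homeomorph.mulLeft σ).isOpenMap _ (isOpen_torsionFixing W (by norm_num))
    refine Filter.mem_of_superset (hopen.mem_nhds ⟨1, (torsionFixing W (4 : ℤ)).one_mem, mul_one σ⟩) ?_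
    rintro _ ⟨h, hh, rfl⟩
    show ξ (σ * h) ∈ S
    rw [hξ_mul, hξ_zero h hh, smul_zero, add_zero]
    exact hσ
  -- ### the class
  let φ : contOneCocycles (discreteTopRep Γ (geomTorsion W (2 : ℤ))) :=
    ⟨⟨ξ, hξ_cont⟩, (mem_contOneCocycles_iff _).mpr fun g h ↦ by
      rw [discreteTopRep_ρ_apply]; exact hξ_mul g h⟩
  have hφ : ∀ σ, φ.1 σ = ξ σ := fun _ ↦ rfl
  refine ⟨oneCocycleClass _ φ, ?_, fun h hh ↦ ?_⟩
  · -- ### non-vanishing: evaluate at a realisation `t` of `u_{E₁₁}`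
    intro h0
    obtain ⟨m, hm⟩ := (oneCocycleClass_eq_zero_iff _ φ).mp h0
    -- the endomorphism `A = E₁₁` of `E[2]` in the frame, realised by `t ∈ Γ_{ℚ(E[2])}`
    let A : geomTorsion W (2 : ℤ) →+ geomTorsion W (2 : ℤ) :=
      e.symm.toAddMonoidHom.comp ((Matrix.toLin' (Matrix.single 0 0 (1 : ZMod 2))).toAddMonoidHom.comp e.toAddMonoidHom)
    have hA : ∀ v : geomTorsion W (2 : ℤ), A v = e.symm ((Matrix.single 0 0 (1 : ZMod 2)) *ᵥ e v) := fun v ↦ by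
      simp [A, Matrix.toLin'_apply]
    obtain ⟨t, ht⟩ := exists_smul_eq_add_apply_two_zsmul W hsurj4 A
    have htT : t ∈ torsionFixing W (2 : ℤ) := mem_torsionFixing_two_of_smul_eq_add W A ht
    -- `D_T(t) = A T`
    have hDt : ∀ T : geomTorsion W (2 : ℤ), D t T = A T := by
      intro T
      apply Subtype.ext
      rw [hD, smul_eq_of_mem_torsionFixing W (2 : ℤ) htT T]
      have h := ht ⟨Ph T, hPh4 T⟩
      change t • Ph T = Ph T + _ at h
      rw [h, add_sub_cancel_left]
      congr 2
      exact Subtype.ext (hPh T)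
    -- `ξ(t) = Σ_v β(A e⁻¹v, e⁻¹v) ≠ 0`
    have hξt : ξ t ≠ 0 := by
      rw [hξ]
      intro hsum
      apply sum_twistForm_single_ne_zero
      have h := congrArg e hsum
      rw [map_sum, map_zero] at h
      rw [← h]
      refine Finset.sum_congr rfl fun v _ ↦ ?_
      rw [hDt, smul_eq_of_mem_torsionFixing W (2 : ℤ) htT, hβ, hA, e.apply_symm_apply, e.apply_symm_apply,
        e.apply_symm_apply]
      rfl
    -- but a coboundary vanishes on `Γ_{ℚ(E[2])}`
    apply hξt
    rw [← hφ, hm t, discreteTopRep_ρ_apply, smul_eq_of_mem_torsionFixing W (2 : ℤ) htT m, sub_self]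
  · rw [h1Eval_oneCocycleClass _ (2 : ℤ) φ (hT42 hh), hφ, hξ_zero h hh]

/-- **`#Inf H¹(Gal(ℚ(E[2^M])/ℚ), E[2]) = 2` EXACTLY, for every `M ≥ 2`** (`2`-adic tower of `W` onto): there is exactly one non-zero class
of `H¹(ℚ, E[2])` dying on `Γ_{ℚ(E[2^M])}` — existence from the level-`4` class (and `Γ_{ℚ(E[2^M])} ≤ Γ_{ℚ(E[4])}`), uniqueness from
`eq_of_forall_torsionFixing_pow_h1Eval_eq_zero`. Lawson–Wuthrich's `H¹(GL₂(ℤ/2^M), 𝔽₂²) = 𝔽₂` in the tree's currency.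
[cite: LawsonWuthrich2016, §3 (Lemma 6, Thm. 1)] -/
theorem existsUnique_ne_zero_forall_torsionFixing_pow_h1Eval_eq_zero
    (hρ : ∀ n : ℕ, 0 < n → W.HasSurjectiveModNGaloisRep ((2 : ℤ) ^ n)) {M : ℕ} (hM : 2 ≤ M) :
    ∃! x : galH1Torsion W (2 : ℤ), x ≠ 0 ∧ ∀ h ∈ torsionFixing W ((2 ^ M : ℕ) : ℤ), h1Eval W (2 : ℤ) x h = 0 := by
  have hsurj4 : W.HasSurjectiveModNGaloisRep 4 := by have h := hρ 2 two_pos; norm_num at h; exact h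
  have h4M : torsionFixing W ((2 ^ M : ℕ) : ℤ) ≤ torsionFixing W (4 : ℤ) :=
    KolyvaginLowerBoundAtTwo.torsionFixing_le_of_dvd W (by
      rw [Nat.cast_pow, Nat.cast_ofNat, show (4 : ℤ) = 2 ^ 2 by norm_num]; exact pow_dvd_pow 2 hM)
  obtain ⟨x, hx0, hx⟩ := exists_ne_zero_forall_torsionFixing_four_h1Eval_eq_zero W hsurj4
  refine ⟨x, ⟨hx0, fun h hh ↦ hx h (h4M hh)⟩, fun y hy ↦ ?_⟩
  exact eq_of_forall_torsionFixing_pow_h1Eval_eq_zero W hρ hM hy.1 hx0 hy.2 (fun h hh ↦ hx h (h4M hh))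

end LevelFourClass

end Summit.BirchSwinnertonDyer.BirchSwinnertonDyer.Theorems.GenusKolyTwistingPrime

end
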